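/-
Copyright: see repository licence. Literature formalisation — Fitzner–van der Hofstad 2017, App. B
"Building blocks with weight": the nine rows of `Σ_ι H^{(3),ι,a,b}(0,v,x,x+y)` and their percolation values.
-/
import Literature.Probability.FitznerVanDerHofstad2017.NobleWeightedBlocks
import Literature.Probability.FitznerVanDerHofstad2017.NobleEntryAbarIotaStZeroTwo
import Literature.Probability.FitznerVanDerHofstad2017.NobleBlocksPercSupport
import Literature.Probability.FitznerVanDerHofstad2017.BubbleTailLiftResidue
import Literature.Probability.FitznerVanDerHofstad2017.BlockSummationAvg
import HarnessLib

/-!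
# [FvdH17] App. B "Building blocks with weight": the rows of `Σ_ι H^{(3),ι,a,b}(0,v,x,x+y)`

[FvdH17] = R. Fitzner, R. van der Hofstad, *Mean-field behavior for nearest-neighbor percolation in d > 10*,
EJP 22 (2017) no. 43 (arXiv:1506.07977v2; page and TeX-line pointers below are to v2); [NoBLE17-I] = R. Fitzner,
R. van der Hofstad, *Generalized approach to the non-backtracking lace expansion*, PTRF 169 (2017) 1041–1119
(arXiv:1506.07969): the weighted diagrams `ℋ^{n,l}_p` of its (3.9) (in the tree
`Literature.Barriers.CriticalPhenomena.nobleH`) and the weighted-bubble bound of its §5.3.3 (p. 1099).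

App. B of [FvdH17] defines the weighted exit block `H^{(3),ι,a,b}(0,v,x,y) = |y − v|² Ā^{ι,a,b,*}(0,v,x,y)`
("Building blocks with weight", TeX l.10605–10613 of arXiv:1506.07977v2; in the tree `NobleBlocks.blockH3` with the
weight `wt z = ‖z‖₂²`), where `Ā^{ι,a,b,*}` is the double-open repulsive triangle of the table "Ā^{ι,a,b}"
(p. 78; `NobleBlocks.blockAbarSt`, rows typed verbatim in `NobleBlocks.blockAbarSt₀`).  Its matrix element enters the
`N = 1` bound through the product `P⃗^S H^{(3)} P⃗^E` ((B.6)–(B.8)).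

## What this module proves (all statements kernel-checked; nothing is assumed)

* §0 — ADDITIVE DECLARATIONS.  `matH3o L := matAbar (blockH3 L)`, the weighted exit matrix in the double-open-gap
  argument pattern `(0,v,x,x+y)` of `(Ā^ι)`, `(C^{(ι)})`, `H^{(1)}`, `H^{(2)}` (`BlockSummation.normOO` / `matAbar`,
  the pattern of `NobleBlocks.matH2`); `vechEo L b := matH3o L 0 b`; and `matH3avg U avg L := matAbarAvg U avg
  (blockH3 L)`, the same element with the class-`1̲` gaps AVERAGED over a finite offset set `U` (the unit vectors),
  [FvdH17] §6.1 p. 59 ("u and w are neighbors"), `BlockSummationAvg.matAbarAvg`.  Reading note: the tree's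
  `NobleBlocks.matH3` / `vechE` keep the argument pattern `(0,v,x+y,y)` exactly as printed on p. 50 (reading note (j)
  of `NobleWeightedBlocks`, DIVERGENCE D66 (j) of the b2b-lace packet, referee number pending); nothing here uses or
  modifies them, and no statement of this module identifies the two patterns.
* §A — THE NINE ROWS FOR A GENERAL LETTER TABLE `L`.  For every `(a,b) ∈ {0,1,2}²` the open-gap fibre
  `Σ_x Σ_ι H^{(3),ι,a,b}(0,v,x,x+y)` (`BlockSummationAvg.openGap` of the `ι`-summed family, `openGap_sum_blockH3`) in
  closed form, read off the table rows of `blockAbarSt₀` with the substitution `y ↦ x + y`: the five rows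
  `(2,2), (1,2), (2,1), (1,1), (0,2)` reduce to ONE kernel
  `Σ_x (Σ_ι [τ_{1̲}(e_ι)] τ(x − e_ι)) ‖w − x‖₂² τ_•(w − x)` times the class prefactors `p`, `p⁻¹ τ_{1̲}(−v)`,
  `p⁻¹ τ_{1̲}(y)`, `p⁻¹ 2dD(v) τ_{1̲}(y)`, `δ_{v,0}`; the rows `(2,0), (1,0), (0,0)` are `δ`-pinned closed weighted
  loops through the pivotal bond (stated EXACTLY, as finite-plus-`Σ_x` expressions in the letters `T`), and `(0,1)`
  is the sum of a pinned `T*` member and an `S*` member.  The primed `(0,0)` row of `NobleBlocksPrime.blockAbarSt₀'`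
  (the `2dp D(x) δ_{0,v} δ_{x,y}`-augmented table of §4.3.2) has the same weighted fibre as the unprimed one
  (`tsum_wt_mul_blockAbarSt'_zero_zero`: the augmentation sits at `y = x`, where the weight `‖y − x‖₂²` vanishes).
* §B — THE PERCOLATION INSTANCE `L = Letters.perc d p`.  The kernel closes on the NoBLE weighted line:
  `Σ_x (Σ_ι τ_p(x − e_ι)) ‖w − x‖₂² τ_p(w − x) = 2d · ℋ^{1,1}_p(w)` (`perc_tsum_kernel_eq_ofReal`; real form
  `two_d_mul_nobleH_one_one_eq_tsum`, hypothesis-free; the `ℝ≥0∞` form under the summability binder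
  `Summable (y ↦ ‖y‖₂² τ_p(y))`, which `summable_sq_mul_tau_of_lt_criticalProbI` supplies for `p < p_c(ℤ^d)`, `d ≥ 2`,
  from the tree's `summable_euclidNorm_sq_mul_tau`).  Consequently rows `(2,2)` and `(0,2)` equal
  `2dp ℋ^{1,1}_p(v − y)` and `δ_{v,0} 2dp ℋ^{1,1}_p(−y)`; rows `(1,2), (2,1), (1,1)` (for `p > 0`, where
  `p⁻¹ τ_{1̲,p} = 2dD`) equal `2dD(v)·`, `2dD(y)·`, `2dD(v) 2dD(y)·` `2dp ℋ^{1,1}_p(v − y)`; rows `(2,0), (1,0)` are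
  AT MOST `δ_{y,0} [2dD(v)] 2dp ℋ^{1,1}_p(v)` (BK, (4.10), `τ_1 ≤ τ`); row `(0,0)` is at most the finite sum
  `δ_{v,0} δ_{y,0} p Σ_ι τ_p(e_ι) Σ_κ ‖e_ι + e_κ‖₂² τ_p(e_ι + e_κ)`; row `(0,1)` at most
  `δ_{v,0} 2dD(y) (p Σ_ι ‖e_ι + y‖₂² τ_p(e_ι + y) + 2dp ℋ^{1,1}_p(−y))`.
* §C — THE ELEMENTS.  `matH3o_{2,2} = matH3o_{0,2} = sup_w 2dp ℋ^{1,1}_p(w)`, `matH3o_{2,0} ≤ sup_w 2dp ℋ^{1,1}_p(w)`,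
  `matH3o_{0,0} ≤` the finite sum above; and the class-`1̲` AVERAGED elements (`matH3avg (unitVecs d)` with the
  selector `a ↦ (a = 1)` of `NobleBlocksAvgPerc`): `(1,2)`, `(2,1)`, `(1,1)` as `sup`/`avgOn` of
  `2dp ℋ^{1,1}_p(v − y)` over unit offsets (the factor `2dD` is `1` there), `(1,0) ≤ avg_{|v|=1} 2dp ℋ^{1,1}_p(v)`,
  `(0,1) ≤ avg_{|y|=1} (…)`.  The further evaluation of the unit-offset averages through `ℋ^{1,2}_p`, `ℋ^{1,3}_p`
  is left to a later module (reading note (5)).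

## Reading notes

(1) The weight.  [FvdH17] App. B: "H^{(3),ι,a,b}(0,v,x,y) = |y−v|² Ā^{ι,a,b,*}(0,v,x,y)"; with the open-gap pattern
`y ↦ x + y` the weight is `‖x + y − v‖₂²`, which in the rows with a `δ_{0,v}` becomes `‖x + y‖₂²` and in the rows
with a `δ_{x,y}` (here `δ_{x,x+y} = δ_{y,0}`, `kd_self_add`) becomes `‖v − x‖₂²`.
(2) `τ_{1̲,p}(z) = p 𝟙{|z| = 1}` and `Ā^{ι,a,1} = p⁻¹ A^{ι,a,1}` (p. 78): the class-`1̲` out-factor `p⁻¹ τ_{1̲,p}(y)` is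
the unit-step indicator `2dD(y)` (`perc_p_inv_mul_tau_eq_one`, `p > 0`); likewise `p⁻¹ τ_{1̲,p}(−v) = 2dD(v)`.
(3) The kernel identity is the definitional unfolding `τ_p^{⋆1} ⋆ D^{⋆1} = τ_p ⋆ D`,
`(τ_p ⋆ D)(z) = (2d)⁻¹ Σ_ι τ_p(z − e_ι)` (`NobleEntryAbarIotaTwoTwo.sum_stepVec_eq_two_d_mul_latticeConv_srwStep`)
followed by the substitution `x = w − y`; the passage `ℝ → ℝ≥0∞` of the infinite sum is where summability is used.
(4) `d` is a free parameter throughout; `d ≥ 1` enters the kernel identity (the step set is non-empty),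
`d ≥ 2` and `p < p_c` only the optional summability supplier `summable_sq_mul_tau_of_lt_criticalProbI`.
(5) The evaluation of the class-`1̲` unit-offset averages through `ℋ^{1,2}_p`, `ℋ^{1,3}_p` ([NoBLE17-I] (3.9) with
`l = 2, 3`), the rows of `H^{(1)}`, `H^{(2)}`, and any relation between `matH3` and `matH3o` are NOT part of this
module.
-/

noncomputable section

namespace Literature.Probability.FitznerVanDerHofstad2017.NobleBlocks

open Literature.Probability.LatticeModels Literature.Probability.Percolation
open Literature.Probability.FitznerVanDerHofstad2017.BlockSummation
open Literature.Barriers.CriticalPhenomena (euclidNorm euclidNorm_nonneg srwStep nobleH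
  summable_euclidNorm_sq_mul_tau)
open Literature.Barriers.CriticalPhenomena.SpreadOutIsing (latticeConv convPow latticeConv_comm convPow_one_eq)
open scoped BigOperators ENNReal

local notation "𝐞" => Literature.Probability.Percolation.stepVec

variable {d : ℕ}

/-! ## 0. The weighted exit matrix in the double-open-gap pattern, and its class-`1̲` average -/

/-- **`(H^{(3),o})_{a,b} = sup_{v,y} Σ_{ι,x} H^{(3),ι,a,b}(0,v,x,x+y)`** — the weighted exit matrix of App. B in the
double-open-gap argument pattern `(0,v,x,x+y)` of `(Ā^ι)`, `(C^{(ι)})`, `H^{(1)}`, `H^{(2)}` (`BlockSummation.matAbar`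
of the weighted family `blockH3`; the pattern of `matH2`).  The printed pattern `(0,v,x+y,y)` of p. 50 is the tree's
`matH3` (reading note (j) of `NobleWeightedBlocks`; DIVERGENCE D66 (j) of the b2b-lace packet, referee number
pending) and is not used here.
[cite: FitznerVanDerHofstad2017, §5.1 "Elements of the bounds" (arXiv:1506.07977v2 p. 50); App. B "Building blocks with weight" and (B.6)–(B.8) (p. 78, TeX l.10605–10613)] -/
def matH3o (L : Letters d) : Matrix (Fin 3) (Fin 3) ℝ≥0∞ := matAbar (blockH3 L)

/-- **`(h^{E,o})_b = (H^{(3),o})_{0,b}`** (column vector of `matH3o`).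
[cite: FitznerVanDerHofstad2017, §5.1 "Elements of the bounds" (arXiv:1506.07977v2 p. 50); App. B (B.6)–(B.8) (p. 78)] -/
def vechEo (L : Letters d) : Fin 3 → ℝ≥0∞ := fun b => matH3o L 0 b

/-- **`(H^{(3),avg})_{a,b}`** — the weighted exit matrix with the gaps of the classes selected by `avg` AVERAGED over
the finite offset set `U` (for `U` = the `2d` unit vectors and `avg = (· = 1)`: the class-`1̲` in-gap `v` and
out-gap `y` range over `|v| = |y| = 1`, [FvdH17] §6.1 p. 59 "u and w are neighbors"), `BlockSummationAvg.matAbarAvg`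
of `blockH3`; entrywise `≤ matH3o` (`matAbarAvg_le_matAbar`).
[cite: FitznerVanDerHofstad2017, §5.1 "Elements of the bounds" (arXiv:1506.07977v2 pp. 49–50) with §6.1 p. 59; App. B (B.6)–(B.8) (p. 78)] -/
def matH3avg (U : Finset (Site d)) (avg : Fin 3 → Bool) (L : Letters d) : Matrix (Fin 3) (Fin 3) ℝ≥0∞ :=
  matAbarAvg U avg (blockH3 L)

/-- Entries of `matH3o`. [cite: FitznerVanDerHofstad2017, §5.1 "Elements of the bounds" (arXiv:1506.07977v2 p. 50)] -/
theorem matH3o_apply (L : Letters d) (a b : Fin 3) :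
    matH3o L a b = ⨆ v, ⨆ y, ∑' x, ∑ ι : Fin d × Bool, blockH3 L ι a b 0 v x (x + y) := rfl

/-- Entries of `matH3avg`. [cite: FitznerVanDerHofstad2017, §5.1 "Elements of the bounds" (arXiv:1506.07977v2 pp. 49–50) with §6.1 p. 59] -/
theorem matH3avg_apply (U : Finset (Site d)) (avg : Fin 3 → Bool) (L : Letters d) (a b : Fin 3) :
    matH3avg U avg L a b = normOOavg U (avg a) (avg b) (fun u v x y => ∑ ι : Fin d × Bool, blockH3 L ι a b u v x y) :=
  rfl

/-- `matH3avg ≤ matH3o` entrywise (an average never exceeds the supremum).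
[cite: FitznerVanDerHofstad2017, §5.1 "Elements of the bounds" (arXiv:1506.07977v2 pp. 49–50) with §6.1 p. 59] -/
theorem matH3avg_le_matH3o (U : Finset (Site d)) (avg : Fin 3 → Bool) (L : Letters d) (a b : Fin 3) :
    matH3avg U avg L a b ≤ matH3o L a b :=
  matAbarAvg_le_matAbar U avg (blockH3 L) a b

/-- Unselected classes are supremised: if `avg a = avg b = false` the averaged entry is the `matH3o` entry.
[cite: FitznerVanDerHofstad2017, §5.1 "Elements of the bounds" (arXiv:1506.07977v2 pp. 49–50)] -/
theorem matH3avg_apply_of_not (U : Finset (Site d)) {avg : Fin 3 → Bool} (L : Letters d) {a b : Fin 3}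
    (ha : avg a = false) (hb : avg b = false) : matH3avg U avg L a b = matH3o L a b := by
  rw [matH3avg_apply, ha, hb, normOOavg_false_false]
  rfl

/-! ## A. The rows of `Σ_ι H^{(3),ι,a,b}(0,v,x,x+y)` for a general letter table -/

section Rows

variable (L : Letters d)

/-- The open-gap fibre of the `ι`-summed weighted family is the sum computed in this module.
[cite: FitznerVanDerHofstad2017, §5.1 "Elements of the bounds" (arXiv:1506.07977v2 p. 49)] -/
theorem openGap_sum_blockH3 (a b : Fin 3) (v y : Site d) :
    openGap (fun u v x y => ∑ ι : Fin d × Bool, blockH3 L ι a b u v x y) v y =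
      ∑' x, ∑ ι : Fin d × Bool, blockH3 L ι a b 0 v x (x + y) := rfl

/-- `δ_{x,x+y} = δ_{y,0}`. [cite: FitznerVanDerHofstad2017, App. B table "Ā^{ι,a,b}", the factors `δ_{x,y}` (arXiv:1506.07977v2 p. 78)] -/
theorem kd_self_add (x y : Site d) : kd x (x + y) = kd y 0 := by
  unfold kd
  by_cases hy : y = 0
  · simp [hy]
  · rw [if_neg (fun h => hy (by simpa using h.symm)), if_neg hy]

/-- `(1 − δ_{z,0}) ‖z‖₂² = ‖z‖₂²` (the weight vanishes at `0`). [cite: FitznerVanDerHofstad2017, App. B "Building blocks with weight" (arXiv:1506.07977v2 TeX l.10613)] -/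
theorem kdc_mul_wt (z : Site d) : kdc z 0 * wt z = wt z := by
  by_cases hz : z = 0
  · simp [hz]
  · rw [kdc_of_ne hz, one_mul]

/-- **Row `(2,2)`**: `Σ_x Σ_ι H^{(3),ι,2,2}(0,v,x,x+y) = p Σ_x (Σ_ι τ(x − e_ι)) ‖v−y−x‖₂² τ(v−y−x)`
(`Ā^{ι,2,2,*}(0,v,x,x+y) = p τ(x−e_ι) τ(v−x−y)`, weight `‖v−(x+y)‖₂²`).
[cite: FitznerVanDerHofstad2017, App. B "Building blocks with weight" (arXiv:1506.07977v2 TeX l.10613) and display "double-open triangle Ā^{ι,a,b}" row (2,2) (p. 78)] -/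
theorem tsum_blockH3_two_two (v y : Site d) :
    ∑' x, ∑ ι : Fin d × Bool, blockH3 L ι 2 2 0 v x (x + y) =
      L.p * ∑' x, (∑ ι : Fin d × Bool, L.tau (.ge 0) (x - 𝐞 ι)) *
        (wt (v - y - x) * L.tau (.ge 0) (v - y - x)) := by
  have h : ∀ ι x, blockH3 L ι 2 2 0 v x (x + y) =
      L.p * (L.tau (.ge 0) (x - 𝐞 ι) * (wt (v - y - x) * L.tau (.ge 0) (v - y - x))) := fun ι x => by
    rw [blockH3, blockAbarSt, ofBase_zero]
    have e : blockAbarSt₀ L ι 2 2 v x (x + y) =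
        L.p * L.tau (.ge 0) (x - 𝐞 ι) * L.tau (.ge 0) (v - (x + y)) := rfl
    rw [e, show v - (x + y) = v - y - x by abel]
    ring
  simp only [h, ← Finset.mul_sum, Finset.sum_mul]
  rw [ENNReal.tsum_mul_left]

/-- **Row `(0,2)`**: `Σ_x Σ_ι H^{(3),ι,0,2}(0,v,x,x+y) = δ_{v,0} Σ_x (Σ_ι τ_{1̲}(e_ι) τ(x−e_ι)) ‖x+y‖₂² τ_1(−(x+y))`
(`Ā^{ι,0,2,*}(0,v,x,x+y) = δ_{0,v} T*_{1,1̲,0}(−x−y, e_ι−x−y, −y)`).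
[cite: FitznerVanDerHofstad2017, App. B (arXiv:1506.07977v2 TeX l.10613) and display "Ā^{ι,a,b}" row (0,2) (p. 78); §4.2 (4.8) (p. 34)] -/
theorem tsum_blockH3_zero_two (v y : Site d) :
    ∑' x, ∑ ι : Fin d × Bool, blockH3 L ι 0 2 0 v x (x + y) =
      kd v 0 * ∑' x, (∑ ι : Fin d × Bool, L.tau (.eq 1) (𝐞 ι) * L.tau (.ge 0) (x - 𝐞 ι)) *
        (wt (x + y) * L.tau (.ge 1) (-(x + y))) := by
  have h : ∀ ι x, blockH3 L ι 0 2 0 v x (x + y) = kd v 0 * (L.tau (.eq 1) (𝐞 ι) * L.tau (.ge 0) (x - 𝐞 ι) *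
      (wt (v - (x + y)) * L.tau (.ge 1) (-(x + y)))) := fun ι x => by
    rw [blockH3, blockAbarSt, ofBase_zero]
    have e : blockAbarSt₀ L ι 0 2 v x (x + y) =
        kd v 0 * L.Tst (.ge 1) (.eq 1) (.ge 0) (-(x + y)) (𝐞 ι - (x + y)) (x - (x + y)) := rfl
    rw [e, Letters.Tst, Letters.Bst, show 𝐞 ι - (x + y) - -(x + y) = 𝐞 ι by abel,
      show x - (x + y) - (𝐞 ι - (x + y)) = x - 𝐞 ι by abel]
    ring
  simp only [h]
  by_cases hv : v = 0
  · subst hv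
    simp only [kd_self, one_mul, zero_sub, wt_neg, ← Finset.sum_mul]
  · simp [kd_of_ne hv]

/-- **Row `(1,2)`**: `Σ_x Σ_ι H^{(3),ι,1,2}(0,v,x,x+y) = p⁻¹ τ_{1̲}(−v) Σ_x (Σ_ι τ_{1̲}(e_ι) τ(x−e_ι)) ‖v−y−x‖₂² τ(v−y−x)`
(`Ā^{ι,1,2,*}(0,v,x,x+y) = p⁻¹ S*_{0,1̲,1̲,0}(v−x−y, −x−y, e_ι−x−y, −y)`).
[cite: FitznerVanDerHofstad2017, App. B (arXiv:1506.07977v2 TeX l.10613) and display "Ā^{ι,a,b}" row (1,2) (p. 78); §4.2 (4.9) (p. 34)] -/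
theorem tsum_blockH3_one_two (v y : Site d) :
    ∑' x, ∑ ι : Fin d × Bool, blockH3 L ι 1 2 0 v x (x + y) =
      L.p⁻¹ * L.tau (.eq 1) (-v) * ∑' x, (∑ ι : Fin d × Bool, L.tau (.eq 1) (𝐞 ι) * L.tau (.ge 0) (x - 𝐞 ι)) *
        (wt (v - y - x) * L.tau (.ge 0) (v - y - x)) := by
  have h : ∀ ι x, blockH3 L ι 1 2 0 v x (x + y) = L.p⁻¹ * L.tau (.eq 1) (-v) *
      (L.tau (.eq 1) (𝐞 ι) * L.tau (.ge 0) (x - 𝐞 ι) * (wt (v - y - x) * L.tau (.ge 0) (v - y - x))) := by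
    intro ι x
    rw [blockH3, blockAbarSt, ofBase_zero]
    have e : blockAbarSt₀ L ι 1 2 v x (x + y) = L.p⁻¹ *
        L.Sst (.ge 0) (.eq 1) (.eq 1) (.ge 0) (v - (x + y)) (-(x + y)) (𝐞 ι - (x + y)) (x - (x + y)) := rfl
    rw [e, Letters.Sst, Letters.Tst, Letters.Bst, show -(x + y) - (v - (x + y)) = -v by abel,
      show 𝐞 ι - (x + y) - -(x + y) = 𝐞 ι by abel, show x - (x + y) - (𝐞 ι - (x + y)) = x - 𝐞 ι by abel,
      show v - (x + y) = v - y - x by abel]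
    ring
  simp only [h, ← Finset.mul_sum, Finset.sum_mul]
  rw [ENNReal.tsum_mul_left]

/-- **Row `(2,1)`**: `Σ_x Σ_ι H^{(3),ι,2,1}(0,v,x,x+y) = p⁻¹ τ_{1̲}(y) Σ_x (Σ_ι τ_{1̲}(e_ι) τ(x−e_ι)) ‖v−y−x‖₂² τ(v−y−x)`
(`Ā^{ι,2,1,*}(0,v,x,x+y) = p⁻¹ S*_{1̲,0,1̲,0}(e_ι, x, x+y, v)`).
[cite: FitznerVanDerHofstad2017, App. B (arXiv:1506.07977v2 TeX l.10613), display "Ā^{ι,a,b}" (p. 78) and Table "A^{ι,a,b}" row (2,1) (p. 75); §5.1 Table "Ā^{ι,a,b,*}" (p. 47)] -/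
theorem tsum_blockH3_two_one (v y : Site d) :
    ∑' x, ∑ ι : Fin d × Bool, blockH3 L ι 2 1 0 v x (x + y) =
      L.p⁻¹ * L.tau (.eq 1) y * ∑' x, (∑ ι : Fin d × Bool, L.tau (.eq 1) (𝐞 ι) * L.tau (.ge 0) (x - 𝐞 ι)) *
        (wt (v - y - x) * L.tau (.ge 0) (v - y - x)) := by
  have h : ∀ ι x, blockH3 L ι 2 1 0 v x (x + y) = L.p⁻¹ * L.tau (.eq 1) y *
      (L.tau (.eq 1) (𝐞 ι) * L.tau (.ge 0) (x - 𝐞 ι) * (wt (v - y - x) * L.tau (.ge 0) (v - y - x))) := by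
    intro ι x
    rw [blockH3, blockAbarSt, ofBase_zero]
    have e : blockAbarSt₀ L ι 2 1 v x (x + y) =
        L.p⁻¹ * L.Sst (.eq 1) (.ge 0) (.eq 1) (.ge 0) (𝐞 ι) x (x + y) v := rfl
    rw [e, Letters.Sst, Letters.Tst, Letters.Bst, add_sub_cancel_left, show v - (x + y) = v - y - x by abel]
    ring
  simp only [h, ← Finset.mul_sum, Finset.sum_mul]
  rw [ENNReal.tsum_mul_left]

/-- **Row `(1,1)`**: `Σ_x Σ_ι H^{(3),ι,1,1}(0,v,x,x+y) = p⁻¹ 2dD(v) τ_{1̲}(y) Σ_x (Σ_ι τ_{1̲}(e_ι) τ(x−e_ι)) ‖v−y−x‖₂² τ(v−y−x)`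
(`Ā^{ι,1,1,*}(0,v,x,x+y) = p⁻¹ 2dD(v) S*_{1̲,0,1̲,0}(e_ι, x, x+y, v)`).
[cite: FitznerVanDerHofstad2017, App. B (arXiv:1506.07977v2 TeX l.10613), display "Ā^{ι,a,b}" (p. 78) and Table "A^{ι,a,b}" row (1,1) (p. 75); §5.1 Table "Ā^{ι,a,b,*}" (p. 47)] -/
theorem tsum_blockH3_one_one (v y : Site d) :
    ∑' x, ∑ ι : Fin d × Bool, blockH3 L ι 1 1 0 v x (x + y) =
      L.p⁻¹ * twoDD v * L.tau (.eq 1) y *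
        ∑' x, (∑ ι : Fin d × Bool, L.tau (.eq 1) (𝐞 ι) * L.tau (.ge 0) (x - 𝐞 ι)) *
          (wt (v - y - x) * L.tau (.ge 0) (v - y - x)) := by
  have h : ∀ ι x, blockH3 L ι 1 1 0 v x (x + y) = L.p⁻¹ * twoDD v * L.tau (.eq 1) y *
      (L.tau (.eq 1) (𝐞 ι) * L.tau (.ge 0) (x - 𝐞 ι) * (wt (v - y - x) * L.tau (.ge 0) (v - y - x))) := by
    intro ι x
    rw [blockH3, blockAbarSt, ofBase_zero]
    have e : blockAbarSt₀ L ι 1 1 v x (x + y) =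
        L.p⁻¹ * (twoDD v * L.Sst (.eq 1) (.ge 0) (.eq 1) (.ge 0) (𝐞 ι) x (x + y) v) := rfl
    rw [e, Letters.Sst, Letters.Tst, Letters.Bst, add_sub_cancel_left, show v - (x + y) = v - y - x by abel]
    ring
  simp only [h, ← Finset.mul_sum, Finset.sum_mul]
  rw [ENNReal.tsum_mul_left]

/-- **Row `(2,0)`**: `Σ_x Σ_ι H^{(3),ι,2,0}(0,v,x,x+y) = δ_{y,0} Σ_x Σ_ι ‖v−x‖₂² T_{1̲,1,0}(e_ι,x,v)`
(`Ā^{ι,2,0,*}(0,v,x,x+y) = δ_{x,x+y} T_{1̲,1,0}(e_ι,x,v)`, repulsive).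
[cite: FitznerVanDerHofstad2017, App. B (arXiv:1506.07977v2 TeX l.10613), display "Ā^{ι,a,b}" (p. 78) and Table "A^{ι,a,b}" row (2,0) (p. 75)] -/
theorem tsum_blockH3_two_zero (v y : Site d) :
    ∑' x, ∑ ι : Fin d × Bool, blockH3 L ι 2 0 0 v x (x + y) =
      kd y 0 * ∑' x, ∑ ι : Fin d × Bool, wt (v - x) * L.T (.eq 1) (.ge 1) (.ge 0) (𝐞 ι) x v := by
  have h : ∀ ι x, blockH3 L ι 2 0 0 v x (x + y) =
      kd y 0 * (wt (v - (x + y)) * L.T (.eq 1) (.ge 1) (.ge 0) (𝐞 ι) x v) := fun ι x => by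
    rw [blockH3, blockAbarSt, ofBase_zero]
    have e : blockAbarSt₀ L ι 2 0 v x (x + y) = kd x (x + y) * L.T (.eq 1) (.ge 1) (.ge 0) (𝐞 ι) x v := rfl
    rw [e, kd_self_add]
    ring
  simp only [h]
  by_cases hy : y = 0
  · subst hy
    simp only [kd_self, one_mul, add_zero]
  · simp [kd_of_ne hy]

/-- **Row `(1,0)`**: `Σ_x Σ_ι H^{(3),ι,1,0}(0,v,x,x+y) = δ_{y,0} 2dD(v) Σ_x Σ_ι (1−δ_{x,0}) ‖v−x‖₂² T_{1̲,1,0}(e_ι,x,v)`.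
[cite: FitznerVanDerHofstad2017, App. B (arXiv:1506.07977v2 TeX l.10613), display "Ā^{ι,a,b}" (p. 78) and Table "A^{ι,a,b}" row (1,0) (p. 75)] -/
theorem tsum_blockH3_one_zero (v y : Site d) :
    ∑' x, ∑ ι : Fin d × Bool, blockH3 L ι 1 0 0 v x (x + y) =
      kd y 0 * twoDD v *
        ∑' x, ∑ ι : Fin d × Bool, kdc x 0 * wt (v - x) * L.T (.eq 1) (.ge 1) (.ge 0) (𝐞 ι) x v := by
  have h : ∀ ι x, blockH3 L ι 1 0 0 v x (x + y) =
      kd y 0 * twoDD v * (kdc x 0 * wt (v - (x + y)) * L.T (.eq 1) (.ge 1) (.ge 0) (𝐞 ι) x v) := by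
    intro ι x
    rw [blockH3, blockAbarSt, ofBase_zero]
    have e : blockAbarSt₀ L ι 1 0 v x (x + y) =
        kd x (x + y) * kdc x 0 * twoDD v * L.T (.eq 1) (.ge 1) (.ge 0) (𝐞 ι) x v := rfl
    rw [e, kd_self_add]
    ring
  simp only [h]
  by_cases hy : y = 0
  · subst hy
    simp only [kd_self, one_mul, add_zero, ← Finset.mul_sum]
    rw [ENNReal.tsum_mul_left]
  · simp [kd_of_ne hy]

/-- **Row `(0,0)`** (App. B table): `Σ_x Σ_ι H^{(3),ι,0,0}(0,v,x,x+y) = δ_{v,0} δ_{y,0} Σ_x Σ_ι (1−δ_{x,e_ι}) ‖x‖₂² T_{1,1̲,1}(e_ι,x,0)`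
(the factor `(1−δ_{v,y}) = (1−δ_{0,x})` is absorbed by the weight `‖x‖₂²`).
[cite: FitznerVanDerHofstad2017, App. B (arXiv:1506.07977v2 TeX l.10613), display "Ā^{ι,a,b}" (p. 78) and Table "A^{ι,a,b}" row (0,0) (p. 75)] -/
theorem tsum_blockH3_zero_zero (v y : Site d) :
    ∑' x, ∑ ι : Fin d × Bool, blockH3 L ι 0 0 0 v x (x + y) =
      kd v 0 * kd y 0 *
        ∑' x, ∑ ι : Fin d × Bool, kdc x (𝐞 ι) * wt x * L.T (.ge 1) (.eq 1) (.ge 1) (𝐞 ι) x 0 := by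
  have h : ∀ ι x, blockH3 L ι 0 0 0 v x (x + y) = kd v 0 * kd y 0 *
      (kdc v (x + y) * wt (v - (x + y)) * (kdc x (𝐞 ι) * L.T (.ge 1) (.eq 1) (.ge 1) (𝐞 ι) x 0)) := by
    intro ι x
    rw [blockH3, blockAbarSt, ofBase_zero]
    have e : blockAbarSt₀ L ι 0 0 v x (x + y) =
        kd x (x + y) * kd v 0 * kdc v (x + y) * kdc x (𝐞 ι) * L.T (.ge 1) (.eq 1) (.ge 1) (𝐞 ι) x 0 := rfl
    rw [e, kd_self_add]
    ring
  simp only [h]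
  by_cases hv : v = 0
  · subst hv
    by_cases hy : y = 0
    · subst hy
      have hk : ∀ x : Site d, kdc 0 x * wt (0 - x) = wt x := fun x => by rw [kdc_comm, zero_sub, wt_neg, kdc_mul_wt]
      simp only [kd_self, one_mul, add_zero, hk, mul_assoc]
      exact tsum_congr fun x => Finset.sum_congr rfl fun ι _ => by ring
    · simp [kd_of_ne hy]
  · simp [kd_of_ne hv]

/-- **Row `(0,0)`, §6.1 reading** (`T_{1̲,1,1}(e_ι,x,0)`, the primed family `Ā^{ι,a,b,*}'`):
`Σ_x Σ_ι ‖v−(x+y)‖₂² Ā^{ι,0,0,*}'(0,v,x,x+y) = δ_{v,0} δ_{y,0} Σ_x Σ_ι (1−δ_{x,e_ι}) ‖x‖₂² T_{1̲,1,1}(e_ι,x,0)`.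
[cite: FitznerVanDerHofstad2017, §6.1 (Bound-Xi-case-abZero) (arXiv:1506.07977v2 p. 59); App. B (TeX l.10613)] -/
theorem tsum_wt_mul_blockAbarSt'_zero_zero (v y : Site d) :
    ∑' x, ∑ ι : Fin d × Bool, wt (v - (x + y)) * blockAbarSt' L ι 0 0 0 v x (x + y) =
      kd v 0 * kd y 0 *
        ∑' x, ∑ ι : Fin d × Bool, kdc x (𝐞 ι) * wt x * L.T (.eq 1) (.ge 1) (.ge 1) (𝐞 ι) x 0 := by
  have h : ∀ ι x, wt (v - (x + y)) * blockAbarSt' L ι 0 0 0 v x (x + y) = kd v 0 * kd y 0 *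
      (kdc v (x + y) * wt (v - (x + y)) * (kdc x (𝐞 ι) * L.T (.eq 1) (.ge 1) (.ge 1) (𝐞 ι) x 0)) := by
    intro ι x
    rw [blockAbarSt', ofBase_zero]
    have e : blockAbarSt₀' L ι 0 0 v x (x + y) =
        kd x (x + y) * kd v 0 * kdc v (x + y) * kdc x (𝐞 ι) * L.T (.eq 1) (.ge 1) (.ge 1) (𝐞 ι) x 0 := by
      rw [blockAbarSt₀', if_pos ⟨rfl, rfl⟩]; rfl
    rw [e, kd_self_add]
    ring
  simp only [h]
  by_cases hv : v = 0
  · subst hv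
    by_cases hy : y = 0
    · subst hy
      have hk : ∀ x : Site d, kdc 0 x * wt (0 - x) = wt x := fun x => by rw [kdc_comm, zero_sub, wt_neg, kdc_mul_wt]
      simp only [kd_self, one_mul, add_zero, hk, mul_assoc]
      exact tsum_congr fun x => Finset.sum_congr rfl fun ι _ => by ring
    · simp [kd_of_ne hy]
  · simp [kd_of_ne hv]

/-- **Row `(0,1)`**: `Σ_x Σ_ι H^{(3),ι,0,1}(0,v,x,x+y) = δ_{v,0} p⁻¹ τ_{1̲}(y) Σ_ι τ_{1̲}(e_ι)
(‖e_ι+y‖₂² τ_2(−(e_ι+y)) + Σ_x τ_1(x−e_ι) ‖x+y‖₂² τ_1(−(x+y)))`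
(`Ā^{ι,0,1,*} = p⁻¹ A^{ι,0,1,*}`, `A^{ι,0,1,*}(0,v,x,x+y) = δ_{v,0}(1−δ_{x+y,v})(δ_{x,e_ι} T*_{1̲,1̲,2}(e_ι,x+y,0) + S*_{1̲,1,1̲,1}(e_ι,x,x+y,0))`).
[cite: FitznerVanDerHofstad2017, App. B (arXiv:1506.07977v2 TeX l.10613), display "Ā^{ι,a,b}" (p. 78) and Table "A^{ι,a,b}" row (0,1) with the sentence after it (p. 75); §4.2 (4.8)–(4.9) (p. 34)] -/
theorem tsum_blockH3_zero_one (v y : Site d) :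
    ∑' x, ∑ ι : Fin d × Bool, blockH3 L ι 0 1 0 v x (x + y) =
      kd v 0 * L.p⁻¹ * L.tau (.eq 1) y * ∑ ι : Fin d × Bool, L.tau (.eq 1) (𝐞 ι) *
        (wt (𝐞 ι + y) * L.tau (.ge 2) (-(𝐞 ι + y)) +
          ∑' x, L.tau (.ge 1) (x - 𝐞 ι) * (wt (x + y) * L.tau (.ge 1) (-(x + y)))) := by
  have h : ∀ ι x, blockH3 L ι 0 1 0 v x (x + y) = kd v 0 * L.p⁻¹ * L.tau (.eq 1) y *
      (kdc (x + y) v * wt (v - (x + y)) * (L.tau (.eq 1) (𝐞 ι) *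
        (kd x (𝐞 ι) * L.tau (.ge 2) (-(x + y)) + L.tau (.ge 1) (x - 𝐞 ι) * L.tau (.ge 1) (-(x + y))))) := by
    intro ι x
    rw [blockH3, blockAbarSt, ofBase_zero]
    have e : blockAbarSt₀ L ι 0 1 v x (x + y) = L.p⁻¹ * (kd v 0 * kdc (x + y) v *
        (kd x (𝐞 ι) * L.Tst (.eq 1) (.eq 1) (.ge 2) (𝐞 ι) (x + y) 0 +
          L.Sst (.eq 1) (.ge 1) (.eq 1) (.ge 1) (𝐞 ι) x (x + y) 0)) := rfl
    rw [e, Letters.Sst, Letters.Tst, Letters.Tst, Letters.Bst, Letters.Bst, add_sub_cancel_left, zero_sub]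
    by_cases hx : x = 𝐞 ι
    · rw [hx, kd_self, add_sub_cancel_left]; ring
    · rw [kd_of_ne hx]; ring
  simp only [h]
  by_cases hv : v = 0
  · subst hv
    have hs : ∀ (ι : Fin d × Bool) (x : Site d), wt (x + y) * (L.tau (.eq 1) (𝐞 ι) *
        (kd x (𝐞 ι) * L.tau (.ge 2) (-(x + y)) + L.tau (.ge 1) (x - 𝐞 ι) * L.tau (.ge 1) (-(x + y)))) =
        L.tau (.eq 1) (𝐞 ι) * (kd x (𝐞 ι) * (wt (x + y) * L.tau (.ge 2) (-(x + y)))) +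
          L.tau (.eq 1) (𝐞 ι) * (L.tau (.ge 1) (x - 𝐞 ι) * (wt (x + y) * L.tau (.ge 1) (-(x + y)))) :=
      fun ι x => by ring
    simp only [kd_self, one_mul, zero_sub, wt_neg, kdc_mul_wt]
    simp only [hs, ← Finset.mul_sum]
    rw [ENNReal.tsum_mul_left, Summable.tsum_finsetSum fun ι _ => ENNReal.summable]
    congr 1
    refine Finset.sum_congr rfl fun ι _ => ?_
    rw [ENNReal.tsum_add, ENNReal.tsum_mul_left, ENNReal.tsum_mul_left, tsum_kd_mul, mul_add]
  · simp [kd_of_ne hv]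

end Rows

/-! ## B. The percolation instance: every closed row is `2dp · ℋ^{1,1}_p`

At `L = Letters.perc d p` the rows of §A close on the NoBLE weighted line
`ℋ^{1,1}_p(w) = Σ_y ‖y‖₂² τ_p(y) (τ_p ⋆ D)(w − y)` through the one identity
`Σ_x (Σ_ι τ_p(x − e_ι)) ‖w−x‖₂² τ_p(w−x) = 2d ℋ^{1,1}_p(w)` (`(τ_p ⋆ D)(z) = (2d)⁻¹ Σ_ι τ_p(z − e_ι)`). -/

section Perc

variable (p : unitInterval)

/-- `τ_{0,p}` at the percolation instance is the two-point function. [cite: FitznerVanDerHofstad2017, §4.2 (4.1) (arXiv:1506.07977v2 p. 34)] -/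
theorem perc_tau_ge_zero_eq (z : Site d) : (Letters.perc d p).tau (.ge 0) z = ENNReal.ofReal (tau d p 0 z) := by
  rw [perc_tau_ge, tauGe_zero_eq_tau]

/-- `τ_p(−z) = τ_p(z)` at the percolation instance. [cite: FitznerVanDerHofstad2017, §4.2 (4.1) (arXiv:1506.07977v2 p. 34)] -/
theorem perc_tau_ge_zero_neg (z : Site d) : (Letters.perc d p).tau (.ge 0) (-z) = (Letters.perc d p).tau (.ge 0) z := by
  rw [perc_tau_ge_zero_eq, perc_tau_ge_zero_eq, tau_zero_neg]

/-- `τ_{1,p} ≤ τ_{0,p}` at the percolation instance. [cite: FitznerVanDerHofstad2017, §4.2 (4.1)–(4.2) (arXiv:1506.07977v2 p. 34)] -/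
theorem perc_tau_ge_le_ge_zero (m : ℕ) (z : Site d) :
    (Letters.perc d p).tau (.ge m) z ≤ (Letters.perc d p).tau (.ge 0) z := by
  rw [perc_tau_ge, perc_tau_ge_zero_eq]
  exact ENNReal.ofReal_le_ofReal (tauGe_le_tau p m z)

/-- `‖z‖₂² τ_{1,p}(−z) = ‖z‖₂² τ_p(z)` (a path between distinct points has at least one step; the weight kills `z = 0`).
[cite: FitznerVanDerHofstad2017, §4.2 (4.1) (arXiv:1506.07977v2 p. 34)] -/
theorem wt_mul_perc_tau_ge_one_neg (z : Site d) :
    wt z * (Letters.perc d p).tau (.ge 1) (-z) = wt z * (Letters.perc d p).tau (.ge 0) z := by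
  by_cases hz : z = 0
  · simp [hz]
  · rw [perc_tau_ge, tauGe_one_eq_tau p (neg_ne_zero.2 hz), tau_zero_neg, perc_tau_ge_zero_eq]

/-- `τ_{1̲,p}(z) = p · 2dD(z)`: an exact-one-bond line is a unit step. [cite: FitznerVanDerHofstad2017, §4.2 "Modified two-point functions" (arXiv:1506.07977v2 p. 34); §5.1 `D(v)` (p. 49)] -/
theorem perc_tau_eq_one_eq (z : Site d) : (Letters.perc d p).tau (.eq 1) z = ENNReal.ofReal p * twoDD z := by
  by_cases hz : z ∈ unitVecs d
  · obtain ⟨ι, rfl⟩ := mem_unitVecs_iff.1 hz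
    rw [perc_tau_eq_one_stepVec, twoDD_stepVec, mul_one]
  · rw [perc_tau_eqOne_eq_zero p hz, twoDD_of_not_mem_unitVecs hz, mul_zero]

/-- `2dD(−z) = 2dD(z)`. [cite: FitznerVanDerHofstad2017, §5.1 `D(v)` (arXiv:1506.07977v2 p. 49)] -/
theorem twoDD_neg (z : Site d) : twoDD (-z) = twoDD z := by
  by_cases hz : z ∈ unitVecs d
  · rw [twoDD_of_mem_unitVecs hz, twoDD_of_mem_unitVecs (neg_mem_unitVecs hz)]
  · rw [twoDD_of_not_mem_unitVecs hz, twoDD_of_not_mem_unitVecs (neg_not_mem_unitVecs hz)]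

/-- `p⁻¹ τ_{1̲,p}(z) = 2dD(z)` for `p > 0`. [cite: FitznerVanDerHofstad2017, App. B display "Ā^{ι,a,1} = (1/p) A^{ι,a,1}" (arXiv:1506.07977v2 p. 78); §5.1 (p. 49)] -/
theorem perc_p_inv_mul_tau_eq_one (hp0 : 0 < (p : ℝ)) (z : Site d) :
    (Letters.perc d p).p⁻¹ * (Letters.perc d p).tau (.eq 1) z = twoDD z := by
  rw [perc_tau_eq_one_eq, perc_p, ← mul_assoc,
    ENNReal.inv_mul_cancel (by rwa [Ne, ENNReal.ofReal_eq_zero, not_le]) ENNReal.ofReal_ne_top, one_mul]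

/-- `Σ_x τ_{1̲,p}(x − e) G(x) = p Σ_κ G(e + e_κ)`: the exact-one-bond line localises the sum to the `2d` neighbours.
[cite: FitznerVanDerHofstad2017, §4.2 "Modified two-point functions" (arXiv:1506.07977v2 p. 34); §6.1 "u and w are neighbors" (p. 59)] -/
theorem perc_tsum_tau_eq_one_sub_mul (e : Site d) (G : Site d → ℝ≥0∞) :
    ∑' x, (Letters.perc d p).tau (.eq 1) (x - e) * G x = ENNReal.ofReal p * ∑ κ : Fin d × Bool, G (e + 𝐞 κ) := by
  rw [← (Equiv.addLeft e).tsum_eq fun x => (Letters.perc d p).tau (.eq 1) (x - e) * G x]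
  simp only [Equiv.coe_addLeft, add_sub_cancel_left]
  rw [tsum_eq_sum (s := unitVecs d) fun z hz => by rw [perc_tau_eqOne_eq_zero p hz, zero_mul], sum_unitVecs,
    Finset.mul_sum]
  exact Finset.sum_congr rfl fun κ _ => by rw [perc_tau_eq_one_stepVec]

/-- `Σ_ι τ_p(w − e_ι) ≤ 2d`. [cite: FitznerVanDerHofstad2017, §4.2 (4.1) (arXiv:1506.07977v2 p. 34)] -/
theorem sum_stepVec_tau_le_two_d (w : Site d) : ∑ ι : Fin d × Bool, tau d p 0 (w - 𝐞 ι) ≤ 2 * d := by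
  calc ∑ ι : Fin d × Bool, tau d p 0 (w - 𝐞 ι) ≤ ∑ _ι : Fin d × Bool, (1 : ℝ) :=
        Finset.sum_le_sum fun ι _ => tau_le_one p 0 _
    _ = 2 * d := by
        rw [Finset.sum_const, Finset.card_univ, Fintype.card_prod, Fintype.card_fin, Fintype.card_bool, nsmul_eq_mul]
        push_cast
        ring

/-- **The kernel identity, real side**: `2d · ℋ^{1,1}_p(w) = Σ_y ‖y‖₂² τ_p(y) Σ_ι τ_p(w − y − e_ι)`
(`τ_p^{⋆1} ⋆ D^{⋆1} = τ_p ⋆ D` and `(τ_p ⋆ D)(z) = (2d)⁻¹ Σ_ι τ_p(z − e_ι)`; no summability needed). `1 ≤ d`.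
[cite: FitznerVanDerHofstad2016NoBLE, (3.9) and (1.2)–(1.3)] [cite: FitznerVanDerHofstad2017, §2.2 (2.21)] -/
theorem two_d_mul_nobleH_one_one_eq_tsum (hd : 1 ≤ d) (w : Site d) :
    2 * d * nobleH d 1 1 p w =
      ∑' y, euclidNorm y ^ 2 * tau d p 0 y * ∑ ι : Fin d × Bool, tau d p 0 (w - y - 𝐞 ι) := by
  unfold nobleH
  rw [← tsum_mul_left]
  refine tsum_congr fun y => ?_
  rw [convPow_one_eq, convPow_one_eq, latticeConv_comm, sum_stepVec_eq_two_d_mul_latticeConv_srwStep hd]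
  ring

/-- The summand of the kernel identity is summable as soon as `Σ_y ‖y‖₂² τ_p(y) < ∞` (since `Σ_ι τ_p ≤ 2d`).
[cite: FitznerVanDerHofstad2017, §2.4 ("[FitHof13b Assumption 2.3]")] [cite: FitznerVanDerHofstad2016NoBLE, Assumption 2.3] -/
theorem summable_sq_mul_tau_mul_sum_stepVec_tau (hH : Summable fun y : Site d => euclidNorm y ^ 2 * tau d p 0 y)
    (w : Site d) :
    Summable fun y : Site d => euclidNorm y ^ 2 * tau d p 0 y * ∑ ι : Fin d × Bool, tau d p 0 (w - y - 𝐞 ι) := by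
  have hs : Summable fun y : Site d => 2 * (d : ℝ) * (euclidNorm y ^ 2 * tau d p 0 y) := hH.mul_left (2 * (d : ℝ))
  refine Summable.of_nonneg_of_le (fun y => mul_nonneg (mul_nonneg (sq_nonneg _) (tau_nonneg p 0 y))
      (Finset.sum_nonneg fun ι _ => tau_nonneg p 0 _)) (fun y => ?_) hs
  calc euclidNorm y ^ 2 * tau d p 0 y * ∑ ι : Fin d × Bool, tau d p 0 (w - y - 𝐞 ι)
      ≤ euclidNorm y ^ 2 * tau d p 0 y * (2 * d) :=
        mul_le_mul_of_nonneg_left (sum_stepVec_tau_le_two_d p (w - y)) (mul_nonneg (sq_nonneg _) (tau_nonneg p 0 y))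
    _ = 2 * d * (euclidNorm y ^ 2 * tau d p 0 y) := by ring

/-- **Summability supplier**: for `d ≥ 2` and `p < p_c(ℤ^d)` the weighted two-point function `y ↦ ‖y‖₂² τ_p(y)` is
summable (the tree's `summable_euclidNorm_sq_mul_tau`, from the exponential decay of `τ_p` below `p_c`).
[cite: FitznerVanDerHofstad2017, §2.4 ("[FitHof13b Assumption 2.3]")] [cite: FitznerVanDerHofstad2016NoBLE, Assumption 2.3] -/
theorem summable_sq_mul_tau_of_lt_criticalProbI (hd : 2 ≤ d) (hp : p < criticalProbI d) :
    Summable fun y : Site d => euclidNorm y ^ 2 * tau d p 0 y :=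
  summable_euclidNorm_sq_mul_tau hd p (show (p : ℝ) < criticalProb (zdGraph d) (0 : Site d) from hp)

/-- **The kernel identity in `ℝ≥0∞`, hypothesis-free form**:
`Σ_x (Σ_ι τ_p(x − e_ι)) ‖w−x‖₂² τ_p(w−x) = Σ_y ofReal(‖y‖₂² τ_p(y) Σ_ι τ_p(w − y − e_ι))` (the substitution `x = w − y`).
[cite: FitznerVanDerHofstad2016NoBLE, (3.9) and (1.2)–(1.3)] [cite: FitznerVanDerHofstad2017, §2.2 (2.21)] -/
theorem perc_tsum_kernel_eq (w : Site d) :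
    ∑' x, (∑ ι : Fin d × Bool, (Letters.perc d p).tau (.ge 0) (x - 𝐞 ι)) *
        (wt (w - x) * (Letters.perc d p).tau (.ge 0) (w - x)) =
      ∑' y, ENNReal.ofReal (euclidNorm y ^ 2 * tau d p 0 y * ∑ ι : Fin d × Bool, tau d p 0 (w - y - 𝐞 ι)) := by
  rw [← (Equiv.subLeft w).tsum_eq fun x => (∑ ι : Fin d × Bool, (Letters.perc d p).tau (.ge 0) (x - 𝐞 ι)) *
    (wt (w - x) * (Letters.perc d p).tau (.ge 0) (w - x))]
  refine tsum_congr fun y => ?_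
  simp only [Equiv.subLeft_apply, sub_sub_cancel, perc_tau_ge_zero_eq, wt]
  rw [ENNReal.ofReal_mul (mul_nonneg (sq_nonneg _) (tau_nonneg p 0 y)), ENNReal.ofReal_mul (sq_nonneg _),
    ENNReal.ofReal_sum_of_nonneg fun ι _ => tau_nonneg p 0 _]
  ring

/-- **The kernel identity**: `Σ_x (Σ_ι τ_p(x − e_ι)) ‖w−x‖₂² τ_p(w−x) = 2d · ℋ^{1,1}_p(w)` in `ℝ≥0∞` (`d ≥ 1`, `Σ_y ‖y‖₂² τ_p(y) < ∞`).
[cite: FitznerVanDerHofstad2016NoBLE, (3.9) and (1.2)–(1.3); §5.3.3 (PTRF 169 (2017) p. 1099)] [cite: FitznerVanDerHofstad2017, §2.2 (2.21)] -/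
theorem perc_tsum_kernel_eq_ofReal (hd : 1 ≤ d) (hH : Summable fun y : Site d => euclidNorm y ^ 2 * tau d p 0 y) (w : Site d) :
    ∑' x, (∑ ι : Fin d × Bool, (Letters.perc d p).tau (.ge 0) (x - 𝐞 ι)) *
        (wt (w - x) * (Letters.perc d p).tau (.ge 0) (w - x)) =
      ENNReal.ofReal (2 * d * nobleH d 1 1 p w) := by
  rw [perc_tsum_kernel_eq, two_d_mul_nobleH_one_one_eq_tsum p hd w]
  exact (ENNReal.ofReal_tsum_of_nonneg (fun y => mul_nonneg (mul_nonneg (sq_nonneg _) (tau_nonneg p 0 y))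
    (Finset.sum_nonneg fun ι _ => tau_nonneg p 0 _)) (summable_sq_mul_tau_mul_sum_stepVec_tau p hH w)).symm

/-- **The kernel identity with the pivotal bond**: `Σ_x (Σ_ι τ_{1̲,p}(e_ι) τ_p(x − e_ι)) ‖w−x‖₂² τ_p(w−x) = 2dp · ℋ^{1,1}_p(w)`.
[cite: FitznerVanDerHofstad2016NoBLE, (3.9); §5.3.3 (PTRF 169 (2017) p. 1099)] [cite: FitznerVanDerHofstad2017, §2.2 (2.21); §4.2 (4.3)] -/
theorem perc_tsum_kernel_one_eq_ofReal (hd : 1 ≤ d) (hH : Summable fun y : Site d => euclidNorm y ^ 2 * tau d p 0 y) (w : Site d) :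
    ∑' x, (∑ ι : Fin d × Bool, (Letters.perc d p).tau (.eq 1) (𝐞 ι) * (Letters.perc d p).tau (.ge 0) (x - 𝐞 ι)) *
        (wt (w - x) * (Letters.perc d p).tau (.ge 0) (w - x)) =
      ENNReal.ofReal (2 * d * p * nobleH d 1 1 p w) := by
  simp only [perc_tau_eq_one_stepVec, ← Finset.mul_sum]
  simp only [mul_assoc]
  rw [ENNReal.tsum_mul_left, perc_tsum_kernel_eq_ofReal p hd hH w, ← ENNReal.ofReal_mul (unitInterval.nonneg p)]
  congr 1
  ring

/-- **Row `(2,2)` at the percolation instance**: `Σ_x Σ_ι H^{(3),ι,2,2}_p(0,v,x,x+y) = 2dp · ℋ^{1,1}_p(v − y)`.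
[cite: FitznerVanDerHofstad2017, App. B "Building blocks with weight" (arXiv:1506.07977v2 TeX l.10613), row (2,2) of "Ā^{ι,a,b}" (p. 78)] [cite: FitznerVanDerHofstad2016NoBLE, (3.9); §5.3.3 (PTRF 169 (2017) p. 1099)] -/
theorem perc_tsum_blockH3_two_two (hd : 1 ≤ d) (hH : Summable fun y : Site d => euclidNorm y ^ 2 * tau d p 0 y) (v y : Site d) :
    ∑' x, ∑ ι : Fin d × Bool, blockH3 (Letters.perc d p) ι 2 2 0 v x (x + y) =
      ENNReal.ofReal (2 * d * p * nobleH d 1 1 p (v - y)) := by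
  rw [tsum_blockH3_two_two, perc_tsum_kernel_eq_ofReal p hd hH (v - y), perc_p,
    ← ENNReal.ofReal_mul (unitInterval.nonneg p)]
  congr 1
  ring

/-- **Row `(0,2)` at the percolation instance**: `Σ_x Σ_ι H^{(3),ι,0,2}_p(0,v,x,x+y) = δ_{v,0} · 2dp · ℋ^{1,1}_p(−y)`
(stated at `−y`; no evenness of `ℋ^{1,1}_p` is used). [cite: FitznerVanDerHofstad2017, App. B (arXiv:1506.07977v2 TeX l.10613), row (0,2) of "Ā^{ι,a,b}" (p. 78)] [cite: FitznerVanDerHofstad2016NoBLE, (3.9); §5.3.3 (PTRF 169 (2017) p. 1099)] -/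
theorem perc_tsum_blockH3_zero_two (hd : 1 ≤ d) (hH : Summable fun y : Site d => euclidNorm y ^ 2 * tau d p 0 y) (v y : Site d) :
    ∑' x, ∑ ι : Fin d × Bool, blockH3 (Letters.perc d p) ι 0 2 0 v x (x + y) =
      kd v 0 * ENNReal.ofReal (2 * d * p * nobleH d 1 1 p (-y)) := by
  rw [tsum_blockH3_zero_two, ← perc_tsum_kernel_one_eq_ofReal p hd hH (-y)]
  congr 1
  refine tsum_congr fun x => ?_
  rw [wt_mul_perc_tau_ge_one_neg, show x + y = -(-y - x) by abel, wt_neg, perc_tau_ge_zero_neg]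

/-- **Row `(1,2)` at the percolation instance** (`p > 0`): `Σ_x Σ_ι H^{(3),ι,1,2}_p(0,v,x,x+y) = 2dD(v) · 2dp · ℋ^{1,1}_p(v − y)`.
[cite: FitznerVanDerHofstad2017, App. B (arXiv:1506.07977v2 TeX l.10613), row (1,2) of "Ā^{ι,a,b}" (p. 78)] [cite: FitznerVanDerHofstad2016NoBLE, (3.9); §5.3.3 (PTRF 169 (2017) p. 1099)] -/
theorem perc_tsum_blockH3_one_two (hd : 1 ≤ d) (hp0 : 0 < (p : ℝ)) (hH : Summable fun y : Site d => euclidNorm y ^ 2 * tau d p 0 y) (v y : Site d) :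
    ∑' x, ∑ ι : Fin d × Bool, blockH3 (Letters.perc d p) ι 1 2 0 v x (x + y) =
      twoDD v * ENNReal.ofReal (2 * d * p * nobleH d 1 1 p (v - y)) := by
  rw [tsum_blockH3_one_two, perc_tsum_kernel_one_eq_ofReal p hd hH (v - y), perc_p_inv_mul_tau_eq_one p hp0,
    twoDD_neg]

/-- **Row `(2,1)` at the percolation instance** (`p > 0`): `Σ_x Σ_ι H^{(3),ι,2,1}_p(0,v,x,x+y) = 2dD(y) · 2dp · ℋ^{1,1}_p(v − y)`.
[cite: FitznerVanDerHofstad2017, App. B (arXiv:1506.07977v2 TeX l.10613), "Ā^{ι,a,1,*} = p⁻¹ A^{ι,a,1,*}" (p. 78) and row (2,1) of "A^{ι,a,b}" (p. 75)] [cite: FitznerVanDerHofstad2016NoBLE, (3.9); §5.3.3 (PTRF 169 (2017) p. 1099)] -/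
theorem perc_tsum_blockH3_two_one (hd : 1 ≤ d) (hp0 : 0 < (p : ℝ)) (hH : Summable fun y : Site d => euclidNorm y ^ 2 * tau d p 0 y) (v y : Site d) :
    ∑' x, ∑ ι : Fin d × Bool, blockH3 (Letters.perc d p) ι 2 1 0 v x (x + y) =
      twoDD y * ENNReal.ofReal (2 * d * p * nobleH d 1 1 p (v - y)) := by
  rw [tsum_blockH3_two_one, perc_tsum_kernel_one_eq_ofReal p hd hH (v - y), perc_p_inv_mul_tau_eq_one p hp0]

/-- **Row `(1,1)` at the percolation instance** (`p > 0`):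
`Σ_x Σ_ι H^{(3),ι,1,1}_p(0,v,x,x+y) = 2dD(v) · 2dD(y) · 2dp · ℋ^{1,1}_p(v − y)`.
[cite: FitznerVanDerHofstad2017, App. B (arXiv:1506.07977v2 TeX l.10613), "Ā^{ι,a,1,*} = p⁻¹ A^{ι,a,1,*}" (p. 78) and row (1,1) of "A^{ι,a,b}" (p. 75)] [cite: FitznerVanDerHofstad2016NoBLE, (3.9); §5.3.3 (PTRF 169 (2017) p. 1099)] -/
theorem perc_tsum_blockH3_one_one (hd : 1 ≤ d) (hp0 : 0 < (p : ℝ)) (hH : Summable fun y : Site d => euclidNorm y ^ 2 * tau d p 0 y) (v y : Site d) :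
    ∑' x, ∑ ι : Fin d × Bool, blockH3 (Letters.perc d p) ι 1 1 0 v x (x + y) =
      twoDD v * twoDD y * ENNReal.ofReal (2 * d * p * nobleH d 1 1 p (v - y)) := by
  rw [tsum_blockH3_one_one, perc_tsum_kernel_one_eq_ofReal p hd hH (v - y),
    show (Letters.perc d p).p⁻¹ * twoDD v * (Letters.perc d p).tau (.eq 1) y =
      twoDD v * ((Letters.perc d p).p⁻¹ * (Letters.perc d p).tau (.eq 1) y) by ring,
    perc_p_inv_mul_tau_eq_one p hp0]

/-- The repulsive triangle with the pivotal bond under the weight is at most the pivotal-bond kernel summand: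
`‖v−x‖₂² 𝓣_{1̲,1,0}(e_ι,x,v) ≤ τ_{1̲}(e_ι) τ(x−e_ι) · ‖v−x‖₂² τ(v−x)` (BK, (4.10), and `τ_1 ≤ τ`).
[cite: FitznerVanDerHofstad2017, §4.2 (4.8), (4.10) (arXiv:1506.07977v2 pp. 34–35)] -/
theorem perc_wt_mul_T_le_kernel (ι : Fin d × Bool) (x v : Site d) :
    wt (v - x) * (Letters.perc d p).T (.eq 1) (.ge 1) (.ge 0) (𝐞 ι) x v ≤
      (Letters.perc d p).tau (.eq 1) (𝐞 ι) * (Letters.perc d p).tau (.ge 0) (x - 𝐞 ι) *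
        (wt (v - x) * (Letters.perc d p).tau (.ge 0) (v - x)) := by
  calc wt (v - x) * (Letters.perc d p).T (.eq 1) (.ge 1) (.ge 0) (𝐞 ι) x v
      ≤ wt (v - x) * (Letters.perc d p).Tst (.eq 1) (.ge 1) (.ge 0) (𝐞 ι) x v :=
        mul_le_mul' le_rfl (perc_T_le_Tst p _ _ _ _ _ _)
    _ = wt (v - x) * ((Letters.perc d p).tau (.eq 1) (𝐞 ι) * (Letters.perc d p).tau (.ge 1) (x - 𝐞 ι) *
          (Letters.perc d p).tau (.ge 0) (v - x)) := by rw [Letters.Tst, Letters.Bst]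
    _ ≤ wt (v - x) * ((Letters.perc d p).tau (.eq 1) (𝐞 ι) * (Letters.perc d p).tau (.ge 0) (x - 𝐞 ι) *
          (Letters.perc d p).tau (.ge 0) (v - x)) := by
        gcongr
        exact perc_tau_ge_le_ge_zero p 1 _
    _ = _ := by ring

/-- **Row `(2,0)` at the percolation instance**: `Σ_x Σ_ι H^{(3),ι,2,0}_p(0,v,x,x+y) ≤ δ_{y,0} · 2dp · ℋ^{1,1}_p(v)`.
[cite: FitznerVanDerHofstad2017, App. B (arXiv:1506.07977v2 TeX l.10613), row (2,0) of "A^{ι,a,b}" (p. 75); §4.2 (4.10) (p. 35)] [cite: FitznerVanDerHofstad2016NoBLE, (3.9); §5.3.3 (PTRF 169 (2017) p. 1099)] -/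
theorem perc_tsum_blockH3_two_zero_le (hd : 1 ≤ d) (hH : Summable fun y : Site d => euclidNorm y ^ 2 * tau d p 0 y) (v y : Site d) :
    ∑' x, ∑ ι : Fin d × Bool, blockH3 (Letters.perc d p) ι 2 0 0 v x (x + y) ≤
      kd y 0 * ENNReal.ofReal (2 * d * p * nobleH d 1 1 p v) := by
  rw [tsum_blockH3_two_zero, ← perc_tsum_kernel_one_eq_ofReal p hd hH v]
  refine mul_le_mul' le_rfl (ENNReal.tsum_le_tsum fun x => ?_)
  rw [Finset.sum_mul]
  exact Finset.sum_le_sum fun ι _ => perc_wt_mul_T_le_kernel p ι x v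

/-- **Row `(1,0)` at the percolation instance**: `Σ_x Σ_ι H^{(3),ι,1,0}_p(0,v,x,x+y) ≤ δ_{y,0} · 2dD(v) · 2dp · ℋ^{1,1}_p(v)`.
[cite: FitznerVanDerHofstad2017, App. B (arXiv:1506.07977v2 TeX l.10613), row (1,0) of "A^{ι,a,b}" (p. 75); §4.2 (4.10) (p. 35)] [cite: FitznerVanDerHofstad2016NoBLE, (3.9); §5.3.3 (PTRF 169 (2017) p. 1099)] -/
theorem perc_tsum_blockH3_one_zero_le (hd : 1 ≤ d) (hH : Summable fun y : Site d => euclidNorm y ^ 2 * tau d p 0 y) (v y : Site d) :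
    ∑' x, ∑ ι : Fin d × Bool, blockH3 (Letters.perc d p) ι 1 0 0 v x (x + y) ≤
      kd y 0 * twoDD v * ENNReal.ofReal (2 * d * p * nobleH d 1 1 p v) := by
  rw [tsum_blockH3_one_zero, ← perc_tsum_kernel_one_eq_ofReal p hd hH v]
  refine mul_le_mul' le_rfl (ENNReal.tsum_le_tsum fun x => ?_)
  rw [Finset.sum_mul]
  refine Finset.sum_le_sum fun ι _ => ?_
  calc kdc x 0 * wt (v - x) * (Letters.perc d p).T (.eq 1) (.ge 1) (.ge 0) (𝐞 ι) x v
      ≤ 1 * wt (v - x) * (Letters.perc d p).T (.eq 1) (.ge 1) (.ge 0) (𝐞 ι) x v := by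
        gcongr
        exact kdc_le_one x 0
    _ ≤ _ := by rw [one_mul]; exact perc_wt_mul_T_le_kernel p ι x v

/-- **Row `(0,0)` at the percolation instance**: the pinned weighted loop through the pivotal bond is a finite sum,
`Σ_x Σ_ι H^{(3),ι,0,0}_p(0,v,x,x+y) ≤ δ_{v,0} δ_{y,0} · p Σ_ι τ_p(e_ι) Σ_κ ‖e_ι+e_κ‖₂² τ_p(e_ι+e_κ)`
(BK (4.10); the line `x − e_ι` of length exactly one localises `x` to `e_ι + e_κ`; `τ_1 ≤ τ`).
[cite: FitznerVanDerHofstad2017, App. B (arXiv:1506.07977v2 TeX l.10613), row (0,0) of "A^{ι,a,b}" (p. 75); §4.2 (4.10) (p. 35)] -/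
theorem perc_tsum_blockH3_zero_zero_le (v y : Site d) :
    ∑' x, ∑ ι : Fin d × Bool, blockH3 (Letters.perc d p) ι 0 0 0 v x (x + y) ≤
      kd v 0 * kd y 0 * ENNReal.ofReal (p * ∑ ι : Fin d × Bool, tau d p 0 (𝐞 ι) *
        ∑ κ : Fin d × Bool, euclidNorm (𝐞 ι + 𝐞 κ : Site d) ^ 2 * tau d p 0 (𝐞 ι + 𝐞 κ)) := by
  rw [tsum_blockH3_zero_zero]
  refine mul_le_mul' le_rfl ?_
  calc ∑' x, ∑ ι : Fin d × Bool, kdc x (𝐞 ι) * wt x * (Letters.perc d p).T (.ge 1) (.eq 1) (.ge 1) (𝐞 ι) x 0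
      ≤ ∑' x, ∑ ι : Fin d × Bool, (Letters.perc d p).tau (.eq 1) (x - 𝐞 ι) *
          ((Letters.perc d p).tau (.ge 0) (𝐞 ι) * (wt x * (Letters.perc d p).tau (.ge 0) x)) := by
        refine ENNReal.tsum_le_tsum fun x => Finset.sum_le_sum fun ι _ => ?_
        calc kdc x (𝐞 ι) * wt x * (Letters.perc d p).T (.ge 1) (.eq 1) (.ge 1) (𝐞 ι) x 0
            ≤ 1 * wt x * (Letters.perc d p).Tst (.ge 1) (.eq 1) (.ge 1) (𝐞 ι) x 0 := by
              gcongr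
              · exact kdc_le_one _ _
              · exact perc_T_le_Tst p _ _ _ _ _ _
          _ = wt x * ((Letters.perc d p).tau (.ge 1) (𝐞 ι) * (Letters.perc d p).tau (.eq 1) (x - 𝐞 ι) *
                (Letters.perc d p).tau (.ge 1) (-x)) := by rw [one_mul, Letters.Tst, Letters.Bst, zero_sub]
          _ = (Letters.perc d p).tau (.eq 1) (x - 𝐞 ι) * ((Letters.perc d p).tau (.ge 1) (𝐞 ι) *
                (wt x * (Letters.perc d p).tau (.ge 1) (-x))) := by ring
          _ ≤ _ := by
              rw [wt_mul_perc_tau_ge_one_neg]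
              gcongr
              exact perc_tau_ge_le_ge_zero p 1 _
    _ = ∑ ι : Fin d × Bool, ENNReal.ofReal p * ∑ κ : Fin d × Bool,
          (Letters.perc d p).tau (.ge 0) (𝐞 ι) * (wt (𝐞 ι + 𝐞 κ) * (Letters.perc d p).tau (.ge 0) (𝐞 ι + 𝐞 κ)) := by
        rw [Summable.tsum_finsetSum fun ι _ => ENNReal.summable]
        exact Finset.sum_congr rfl fun ι _ => perc_tsum_tau_eq_one_sub_mul p (𝐞 ι) _
    _ = _ := by
        rw [← Finset.mul_sum, ENNReal.ofReal_mul (unitInterval.nonneg p),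
          ENNReal.ofReal_sum_of_nonneg fun ι _ => mul_nonneg (tau_nonneg p 0 _)
            (Finset.sum_nonneg fun κ _ => mul_nonneg (sq_nonneg _) (tau_nonneg p 0 _))]
        congr 1
        refine Finset.sum_congr rfl fun ι _ => ?_
        rw [← Finset.mul_sum, ENNReal.ofReal_mul (tau_nonneg p 0 _),
          ENNReal.ofReal_sum_of_nonneg fun κ _ => mul_nonneg (sq_nonneg _) (tau_nonneg p 0 _), perc_tau_ge_zero_eq]
        congr 1
        refine Finset.sum_congr rfl fun κ _ => ?_
        rw [wt, perc_tau_ge_zero_eq, ENNReal.ofReal_mul (sq_nonneg _)]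

/-- **Row `(0,1)` at the percolation instance** (`p > 0`): `Σ_x Σ_ι H^{(3),ι,0,1}_p(0,v,x,x+y) ≤
δ_{v,0} 2dD(y) · (p Σ_ι ‖e_ι+y‖₂² τ_p(e_ι+y) + 2dp · ℋ^{1,1}_p(−y))` (the `δ_{x,e_ι} T*` member is a finite sum, the
`S*` member closes on the kernel; `τ_2, τ_1 ≤ τ`).
[cite: FitznerVanDerHofstad2017, App. B (arXiv:1506.07977v2 TeX l.10613), "Ā^{ι,a,1,*} = p⁻¹ A^{ι,a,1,*}" (p. 78) and row (0,1) of "A^{ι,a,b}" (p. 75)] [cite: FitznerVanDerHofstad2016NoBLE, (3.9); §5.3.3 (PTRF 169 (2017) p. 1099)] -/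
theorem perc_tsum_blockH3_zero_one_le (hd : 1 ≤ d) (hp0 : 0 < (p : ℝ)) (hH : Summable fun y : Site d => euclidNorm y ^ 2 * tau d p 0 y) (v y : Site d) :
    ∑' x, ∑ ι : Fin d × Bool, blockH3 (Letters.perc d p) ι 0 1 0 v x (x + y) ≤
      kd v 0 * twoDD y *
        (ENNReal.ofReal (p * ∑ ι : Fin d × Bool, euclidNorm (𝐞 ι + y : Site d) ^ 2 * tau d p 0 (𝐞 ι + y)) +
          ENNReal.ofReal (2 * d * p * nobleH d 1 1 p (-y))) := by
  have hA : ∀ ι : Fin d × Bool, wt (𝐞 ι + y) * (Letters.perc d p).tau (.ge 2) (-(𝐞 ι + y)) ≤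
      wt (𝐞 ι + y) * (Letters.perc d p).tau (.ge 0) (𝐞 ι + y) := fun ι => by
    calc wt (𝐞 ι + y) * (Letters.perc d p).tau (.ge 2) (-(𝐞 ι + y))
        ≤ wt (𝐞 ι + y) * (Letters.perc d p).tau (.ge 1) (-(𝐞 ι + y)) := by
          refine mul_le_mul' le_rfl ?_
          rw [perc_tau_ge, perc_tau_ge]
          exact ENNReal.ofReal_le_ofReal (tauGe_anti p (by norm_num) _)
      _ = _ := wt_mul_perc_tau_ge_one_neg p _
  have hB : ∀ (ι : Fin d × Bool) (x : Site d),
      (Letters.perc d p).tau (.ge 1) (x - 𝐞 ι) * (wt (x + y) * (Letters.perc d p).tau (.ge 1) (-(x + y))) ≤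
        (Letters.perc d p).tau (.ge 0) (x - 𝐞 ι) * (wt (-y - x) * (Letters.perc d p).tau (.ge 0) (-y - x)) := by
    intro ι x
    rw [wt_mul_perc_tau_ge_one_neg, show x + y = -(-y - x) by abel, wt_neg, perc_tau_ge_zero_neg]
    exact mul_le_mul' (perc_tau_ge_le_ge_zero p 1 _) le_rfl
  have hfin : ∑ ι : Fin d × Bool, ENNReal.ofReal p * (wt (𝐞 ι + y) * (Letters.perc d p).tau (.ge 0) (𝐞 ι + y)) =
      ENNReal.ofReal (p * ∑ ι : Fin d × Bool, euclidNorm (𝐞 ι + y : Site d) ^ 2 * tau d p 0 (𝐞 ι + y)) := by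
    rw [← Finset.mul_sum, ENNReal.ofReal_mul (unitInterval.nonneg p),
      ENNReal.ofReal_sum_of_nonneg fun ι _ => mul_nonneg (sq_nonneg _) (tau_nonneg p 0 _)]
    congr 1
    refine Finset.sum_congr rfl fun ι _ => ?_
    rw [wt, perc_tau_ge_zero_eq, ENNReal.ofReal_mul (sq_nonneg _)]
  have hker : ∑ ι : Fin d × Bool, ENNReal.ofReal p *
      ∑' x, (Letters.perc d p).tau (.ge 0) (x - 𝐞 ι) * (wt (-y - x) * (Letters.perc d p).tau (.ge 0) (-y - x)) =
        ENNReal.ofReal (2 * d * p * nobleH d 1 1 p (-y)) := by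
    rw [← perc_tsum_kernel_one_eq_ofReal p hd hH (-y)]
    simp only [perc_tau_eq_one_stepVec, Finset.sum_mul, mul_assoc]
    rw [Summable.tsum_finsetSum fun ι _ => ENNReal.summable]
    simp only [ENNReal.tsum_mul_left]
  rw [tsum_blockH3_zero_one, mul_assoc (kd v 0), perc_p_inv_mul_tau_eq_one p hp0 y, ← hfin, ← hker,
    ← Finset.sum_add_distrib]
  refine mul_le_mul' le_rfl (Finset.sum_le_sum fun ι _ => ?_)
  rw [perc_tau_eq_one_stepVec, mul_add]
  exact add_le_add (mul_le_mul' le_rfl (hA ι)) (mul_le_mul' le_rfl (ENNReal.tsum_le_tsum (hB ι)))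

end Perc

/-! ## C. The elements: suprema and unit-offset averages of the rows -/

section Elements

variable (p : unitInterval)

/-- On the unit vectors the factor `2dD(v)` is `1`: it disappears under the unit-offset average. [cite: FitznerVanDerHofstad2017, §5.1 "Elements of the bounds" (arXiv:1506.07977v2 p. 49); §6.1 p. 59] -/
theorem avgOn_unitVecs_twoDD_mul (G : Site d → ℝ≥0∞) :
    avgOn (unitVecs d) (fun v => twoDD v * G v) = avgOn (unitVecs d) G := by
  rw [avgOn_def, avgOn_def]
  congr 1
  exact Finset.sum_congr rfl fun v hv => by rw [twoDD_of_mem_unitVecs hv, one_mul]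

/-- **Element `(2,2)`** of the weighted matrix at the percolation instance: `(Σ_ι H^{(3),ι}_p)_{2,2} = sup_w 2dp ℋ^{1,1}_p(w)`
(the two suprema merge into one over `w = v − y`).
[cite: FitznerVanDerHofstad2017, §5.1 "Elements of the bounds" (arXiv:1506.07977v2 p. 49); App. B (TeX l.10613)] [cite: FitznerVanDerHofstad2016NoBLE, (3.9); §5.3.3 (PTRF 169 (2017) p. 1099)] -/
theorem perc_matH3o_two_two (hd : 1 ≤ d) (hH : Summable fun y : Site d => euclidNorm y ^ 2 * tau d p 0 y) :
    matH3o (Letters.perc d p) 2 2 = ⨆ w, ENNReal.ofReal (2 * d * p * nobleH d 1 1 p w) := by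
  rw [matH3o_apply]
  simp only [perc_tsum_blockH3_two_two p hd hH]
  exact iSup_iSup_sub_eq fun w => ENNReal.ofReal (2 * d * p * nobleH d 1 1 p w)

/-- **Element `(0,2)`**: `(Σ_ι H^{(3),ι}_p)_{0,2} = sup_w 2dp ℋ^{1,1}_p(w)` (`v = 0`; the out-gap `y ↦ −y` is a bijection).
[cite: FitznerVanDerHofstad2017, §5.1 "Elements of the bounds" (arXiv:1506.07977v2 p. 49); App. B (TeX l.10613)] [cite: FitznerVanDerHofstad2016NoBLE, (3.9); §5.3.3 (PTRF 169 (2017) p. 1099)] -/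
theorem perc_matH3o_zero_two (hd : 1 ≤ d) (hH : Summable fun y : Site d => euclidNorm y ^ 2 * tau d p 0 y) :
    matH3o (Letters.perc d p) 0 2 = ⨆ w, ENNReal.ofReal (2 * d * p * nobleH d 1 1 p w) := by
  rw [matH3o_apply]
  simp only [perc_tsum_blockH3_zero_two p hd hH]
  rw [iSup_eq_apply_zero (fun v : Site d => ⨆ y, kd v 0 * ENNReal.ofReal (2 * d * p * nobleH d 1 1 p (-y)))
    fun v hv => by simp [kd_of_ne hv]]
  simp only [kd_self, one_mul]
  exact (Equiv.neg (Site d)).iSup_comp (g := fun w => ENNReal.ofReal (2 * d * p * nobleH d 1 1 p w))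

/-- **Element `(2,0)`**: `(Σ_ι H^{(3),ι}_p)_{2,0} ≤ sup_w 2dp ℋ^{1,1}_p(w)`.
[cite: FitznerVanDerHofstad2017, §5.1 "Elements of the bounds" (arXiv:1506.07977v2 p. 49); App. B (TeX l.10613); §4.2 (4.10)] [cite: FitznerVanDerHofstad2016NoBLE, (3.9); §5.3.3 (PTRF 169 (2017) p. 1099)] -/
theorem perc_matH3o_two_zero_le (hd : 1 ≤ d) (hH : Summable fun y : Site d => euclidNorm y ^ 2 * tau d p 0 y) :
    matH3o (Letters.perc d p) 2 0 ≤ ⨆ w, ENNReal.ofReal (2 * d * p * nobleH d 1 1 p w) := by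
  rw [matH3o_apply]
  refine iSup_le fun v => iSup_le fun y => (perc_tsum_blockH3_two_zero_le p hd hH v y).trans ?_
  calc kd y 0 * ENNReal.ofReal (2 * d * p * nobleH d 1 1 p v)
      ≤ 1 * ENNReal.ofReal (2 * d * p * nobleH d 1 1 p v) := mul_le_mul' (kd_le_one _ _) le_rfl
    _ ≤ _ := by rw [one_mul]; exact le_iSup (fun w => ENNReal.ofReal (2 * d * p * nobleH d 1 1 p w)) v

/-- **Element `(0,0)`**: `(Σ_ι H^{(3),ι}_p)_{0,0} ≤ p Σ_ι τ_p(e_ι) Σ_κ ‖e_ι+e_κ‖₂² τ_p(e_ι+e_κ)` (a finite sum).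
[cite: FitznerVanDerHofstad2017, §5.1 "Elements of the bounds" (arXiv:1506.07977v2 p. 49); App. B (TeX l.10613); §4.2 (4.10)] -/
theorem perc_matH3o_zero_zero_le :
    matH3o (Letters.perc d p) 0 0 ≤ ENNReal.ofReal (p * ∑ ι : Fin d × Bool, tau d p 0 (𝐞 ι) *
      ∑ κ : Fin d × Bool, euclidNorm (𝐞 ι + 𝐞 κ : Site d) ^ 2 * tau d p 0 (𝐞 ι + 𝐞 κ)) := by
  rw [matH3o_apply]
  refine iSup_le fun v => iSup_le fun y => (perc_tsum_blockH3_zero_zero_le p v y).trans ?_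
  calc kd v 0 * kd y 0 * _ ≤ 1 * 1 * _ := by gcongr <;> exact kd_le_one _ _
    _ = _ := by rw [one_mul, one_mul]

/-- **Element `(1,0)`, in-class `1̲` averaged over the `2d` unit offsets**:
`sup_y (2d)⁻¹ Σ_{|v|=1} Σ_x Σ_ι H^{(3),ι,1,0}_p(0,v,x,x+y) ≤ (2d)⁻¹ Σ_{|v|=1} 2dp ℋ^{1,1}_p(v)`.
[cite: FitznerVanDerHofstad2017, §5.1 "Elements of the bounds" (arXiv:1506.07977v2 p. 49) with §6.1 p. 59 ("u and w are neighbors"); App. B (TeX l.10613)] [cite: FitznerVanDerHofstad2016NoBLE, (3.9); §5.3.3 (PTRF 169 (2017) p. 1099)] -/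
theorem perc_normOOavg_blockH3_one_zero_le (hd : 1 ≤ d) (hH : Summable fun y : Site d => euclidNorm y ^ 2 * tau d p 0 y) :
    normOOavg (unitVecs d) true false (fun u v x y => ∑ ι : Fin d × Bool, blockH3 (Letters.perc d p) ι 1 0 u v x y) ≤
      avgOn (unitVecs d) fun v => ENNReal.ofReal (2 * d * p * nobleH d 1 1 p v) := by
  rw [normOOavg_true_false]
  refine iSup_le fun y => avgOn_mono _ fun v _ => ?_
  rw [openGap_sum_blockH3]
  refine (perc_tsum_blockH3_one_zero_le p hd hH v y).trans ?_
  calc kd y 0 * twoDD v * _ ≤ 1 * 1 * _ := by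
        gcongr
        · exact kd_le_one _ _
        · exact twoDD_le_one _
    _ = _ := by rw [one_mul, one_mul]

/-- **Element `(0,1)`, out-class `1̲` averaged** (`p > 0`):
`sup_v (2d)⁻¹ Σ_{|y|=1} Σ_x Σ_ι H^{(3),ι,0,1}_p(0,v,x,x+y) ≤ (2d)⁻¹ Σ_{|y|=1} (p Σ_ι ‖e_ι+y‖₂² τ_p(e_ι+y) + 2dp ℋ^{1,1}_p(−y))`.
[cite: FitznerVanDerHofstad2017, §5.1 "Elements of the bounds" (arXiv:1506.07977v2 p. 49) with §6.1 p. 59; App. B (TeX l.10613)] [cite: FitznerVanDerHofstad2016NoBLE, (3.9); §5.3.3 (PTRF 169 (2017) p. 1099)] -/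
theorem perc_normOOavg_blockH3_zero_one_le (hd : 1 ≤ d) (hp0 : 0 < (p : ℝ)) (hH : Summable fun y : Site d => euclidNorm y ^ 2 * tau d p 0 y) :
    normOOavg (unitVecs d) false true (fun u v x y => ∑ ι : Fin d × Bool, blockH3 (Letters.perc d p) ι 0 1 u v x y) ≤
      avgOn (unitVecs d) fun y =>
        ENNReal.ofReal (p * ∑ ι : Fin d × Bool, euclidNorm (𝐞 ι + y : Site d) ^ 2 * tau d p 0 (𝐞 ι + y)) +
          ENNReal.ofReal (2 * d * p * nobleH d 1 1 p (-y)) := by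
  rw [normOOavg_false_true]
  refine iSup_le fun v => avgOn_mono _ fun y _ => ?_
  rw [openGap_sum_blockH3]
  refine (perc_tsum_blockH3_zero_one_le p hd hp0 hH v y).trans ?_
  calc kd v 0 * twoDD y * _ ≤ 1 * 1 * _ := by
        gcongr
        · exact kd_le_one _ _
        · exact twoDD_le_one _
    _ = _ := by rw [one_mul, one_mul]

/-- **Element `(1,2)`, in-class `1̲` averaged** (`p > 0`): `sup_y (2d)⁻¹ Σ_{|v|=1} Σ_x Σ_ι H^{(3),ι,1,2}_p(0,v,x,x+y)
= sup_y (2d)⁻¹ Σ_{|v|=1} 2dp ℋ^{1,1}_p(v − y)`.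
[cite: FitznerVanDerHofstad2017, §5.1 "Elements of the bounds" (arXiv:1506.07977v2 p. 49) with §6.1 p. 59; App. B (TeX l.10613)] [cite: FitznerVanDerHofstad2016NoBLE, (3.9); §5.3.3 (PTRF 169 (2017) p. 1099)] -/
theorem perc_normOOavg_blockH3_one_two (hd : 1 ≤ d) (hp0 : 0 < (p : ℝ)) (hH : Summable fun y : Site d => euclidNorm y ^ 2 * tau d p 0 y) :
    normOOavg (unitVecs d) true false (fun u v x y => ∑ ι : Fin d × Bool, blockH3 (Letters.perc d p) ι 1 2 u v x y) =
      ⨆ y, avgOn (unitVecs d) fun v => ENNReal.ofReal (2 * d * p * nobleH d 1 1 p (v - y)) := by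
  rw [normOOavg_true_false]
  refine iSup_congr fun y => ?_
  simp only [openGap_sum_blockH3, perc_tsum_blockH3_one_two p hd hp0 hH]
  exact avgOn_unitVecs_twoDD_mul _

/-- **Element `(2,1)`, out-class `1̲` averaged** (`p > 0`): `sup_v (2d)⁻¹ Σ_{|y|=1} Σ_x Σ_ι H^{(3),ι,2,1}_p(0,v,x,x+y)
= sup_v (2d)⁻¹ Σ_{|y|=1} 2dp ℋ^{1,1}_p(v − y)`.
[cite: FitznerVanDerHofstad2017, §5.1 "Elements of the bounds" (arXiv:1506.07977v2 p. 49) with §6.1 p. 59; App. B (TeX l.10613)] [cite: FitznerVanDerHofstad2016NoBLE, (3.9); §5.3.3 (PTRF 169 (2017) p. 1099)] -/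
theorem perc_normOOavg_blockH3_two_one (hd : 1 ≤ d) (hp0 : 0 < (p : ℝ)) (hH : Summable fun y : Site d => euclidNorm y ^ 2 * tau d p 0 y) :
    normOOavg (unitVecs d) false true (fun u v x y => ∑ ι : Fin d × Bool, blockH3 (Letters.perc d p) ι 2 1 u v x y) =
      ⨆ v, avgOn (unitVecs d) fun y => ENNReal.ofReal (2 * d * p * nobleH d 1 1 p (v - y)) := by
  rw [normOOavg_false_true]
  refine iSup_congr fun v => ?_
  simp only [openGap_sum_blockH3, perc_tsum_blockH3_two_one p hd hp0 hH]
  exact avgOn_unitVecs_twoDD_mul _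

/-- **Element `(1,1)`, both classes averaged** (`p > 0`): `(2d)⁻² Σ_{|v|=|y|=1} Σ_x Σ_ι H^{(3),ι,1,1}_p(0,v,x,x+y)
= (2d)⁻² Σ_{|v|=|y|=1} 2dp ℋ^{1,1}_p(v − y)`.
[cite: FitznerVanDerHofstad2017, §5.1 "Elements of the bounds" (arXiv:1506.07977v2 p. 49) with §6.1 p. 59; App. B (TeX l.10613)] [cite: FitznerVanDerHofstad2016NoBLE, (3.9); §5.3.3 (PTRF 169 (2017) p. 1099)] -/
theorem perc_normOOavg_blockH3_one_one (hd : 1 ≤ d) (hp0 : 0 < (p : ℝ)) (hH : Summable fun y : Site d => euclidNorm y ^ 2 * tau d p 0 y) :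
    normOOavg (unitVecs d) true true (fun u v x y => ∑ ι : Fin d × Bool, blockH3 (Letters.perc d p) ι 1 1 u v x y) =
      avgOn (unitVecs d) fun v => avgOn (unitVecs d) fun y => ENNReal.ofReal (2 * d * p * nobleH d 1 1 p (v - y)) := by
  rw [normOOavg_true_true]
  simp only [openGap_sum_blockH3, perc_tsum_blockH3_one_one p hd hp0 hH]
  rw [avgOn_def, avgOn_def]
  congr 1
  refine Finset.sum_congr rfl fun v hv => ?_
  simp only [twoDD_of_mem_unitVecs hv, one_mul]
  exact avgOn_unitVecs_twoDD_mul _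

/-- `(h^{E,o})_2 = sup_w 2dp ℋ^{1,1}_p(w)` at the percolation instance.
[cite: FitznerVanDerHofstad2017, §5.1 "Elements of the bounds" (arXiv:1506.07977v2 p. 50); App. B (B.6)–(B.8) (p. 78)] [cite: FitznerVanDerHofstad2016NoBLE, (3.9); §5.3.3 (PTRF 169 (2017) p. 1099)] -/
theorem perc_vechEo_two (hd : 1 ≤ d) (hH : Summable fun y : Site d => euclidNorm y ^ 2 * tau d p 0 y) :
    vechEo (Letters.perc d p) 2 = ⨆ w, ENNReal.ofReal (2 * d * p * nobleH d 1 1 p w) :=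
  perc_matH3o_zero_two p hd hH

/-- `(h^{E,o})_0 ≤ p Σ_ι τ_p(e_ι) Σ_κ ‖e_ι+e_κ‖₂² τ_p(e_ι+e_κ)` at the percolation instance.
[cite: FitznerVanDerHofstad2017, §5.1 "Elements of the bounds" (arXiv:1506.07977v2 p. 50); App. B (B.6)–(B.8) (p. 78); §4.2 (4.10)] -/
theorem perc_vechEo_zero_le :
    vechEo (Letters.perc d p) 0 ≤ ENNReal.ofReal (p * ∑ ι : Fin d × Bool, tau d p 0 (𝐞 ι) *
      ∑ κ : Fin d × Bool, euclidNorm (𝐞 ι + 𝐞 κ : Site d) ^ 2 * tau d p 0 (𝐞 ι + 𝐞 κ)) :=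
  perc_matH3o_zero_zero_le p

/-- The class-`0`/`2` entries of the unit-offset averaged matrix are those of `matH3o` (selector `a ↦ (a = 1)`).
[cite: FitznerVanDerHofstad2017, §5.1 "Elements of the bounds" (arXiv:1506.07977v2 pp. 49–50)] -/
theorem matH3avg_unitVecs_two_two (L : Letters d) :
    matH3avg (unitVecs d) (fun a : Fin 3 => decide (a = 1)) L 2 2 = matH3o L 2 2 :=
  matH3avg_apply_of_not (unitVecs d) L (by decide) (by decide)

/-- **Averaged element `(1,0)`** (selector `a ↦ (a = 1)`): `matH3avg_{1,0} ≤ (2d)⁻¹ Σ_{|v|=1} 2dp ℋ^{1,1}_p(v)`.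
[cite: FitznerVanDerHofstad2017, §5.1 "Elements of the bounds" (arXiv:1506.07977v2 p. 49) with §6.1 p. 59; App. B (TeX l.10613)] [cite: FitznerVanDerHofstad2016NoBLE, (3.9); §5.3.3 (PTRF 169 (2017) p. 1099)] -/
theorem perc_matH3avg_one_zero_le (hd : 1 ≤ d) (hH : Summable fun y : Site d => euclidNorm y ^ 2 * tau d p 0 y) :
    matH3avg (unitVecs d) (fun a : Fin 3 => decide (a = 1)) (Letters.perc d p) 1 0 ≤
      avgOn (unitVecs d) fun v => ENNReal.ofReal (2 * d * p * nobleH d 1 1 p v) := by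
  rw [matH3avg_apply]
  exact perc_normOOavg_blockH3_one_zero_le p hd hH

/-- **Averaged element `(0,1)`** (selector `a ↦ (a = 1)`, `p > 0`):
`matH3avg_{0,1} ≤ (2d)⁻¹ Σ_{|y|=1} (p Σ_ι ‖e_ι+y‖₂² τ_p(e_ι+y) + 2dp ℋ^{1,1}_p(−y))`.
[cite: FitznerVanDerHofstad2017, §5.1 "Elements of the bounds" (arXiv:1506.07977v2 p. 49) with §6.1 p. 59; App. B (TeX l.10613)] [cite: FitznerVanDerHofstad2016NoBLE, (3.9); §5.3.3 (PTRF 169 (2017) p. 1099)] -/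
theorem perc_matH3avg_zero_one_le (hd : 1 ≤ d) (hp0 : 0 < (p : ℝ))
    (hH : Summable fun y : Site d => euclidNorm y ^ 2 * tau d p 0 y) :
    matH3avg (unitVecs d) (fun a : Fin 3 => decide (a = 1)) (Letters.perc d p) 0 1 ≤
      avgOn (unitVecs d) fun y =>
        ENNReal.ofReal (p * ∑ ι : Fin d × Bool, euclidNorm (𝐞 ι + y : Site d) ^ 2 * tau d p 0 (𝐞 ι + y)) +
          ENNReal.ofReal (2 * d * p * nobleH d 1 1 p (-y)) := by
  rw [matH3avg_apply]
  exact perc_normOOavg_blockH3_zero_one_le p hd hp0 hH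

/-- **Averaged element `(1,2)`** (selector `a ↦ (a = 1)`, `p > 0`): `matH3avg_{1,2} = sup_y (2d)⁻¹ Σ_{|v|=1} 2dp ℋ^{1,1}_p(v − y)`.
[cite: FitznerVanDerHofstad2017, §5.1 "Elements of the bounds" (arXiv:1506.07977v2 p. 49) with §6.1 p. 59; App. B (TeX l.10613)] [cite: FitznerVanDerHofstad2016NoBLE, (3.9); §5.3.3 (PTRF 169 (2017) p. 1099)] -/
theorem perc_matH3avg_one_two (hd : 1 ≤ d) (hp0 : 0 < (p : ℝ))
    (hH : Summable fun y : Site d => euclidNorm y ^ 2 * tau d p 0 y) :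
    matH3avg (unitVecs d) (fun a : Fin 3 => decide (a = 1)) (Letters.perc d p) 1 2 =
      ⨆ y, avgOn (unitVecs d) fun v => ENNReal.ofReal (2 * d * p * nobleH d 1 1 p (v - y)) := by
  rw [matH3avg_apply]
  exact perc_normOOavg_blockH3_one_two p hd hp0 hH

/-- **Averaged element `(2,1)`** (selector `a ↦ (a = 1)`, `p > 0`): `matH3avg_{2,1} = sup_v (2d)⁻¹ Σ_{|y|=1} 2dp ℋ^{1,1}_p(v − y)`.
[cite: FitznerVanDerHofstad2017, §5.1 "Elements of the bounds" (arXiv:1506.07977v2 p. 49) with §6.1 p. 59; App. B (TeX l.10613)] [cite: FitznerVanDerHofstad2016NoBLE, (3.9); §5.3.3 (PTRF 169 (2017) p. 1099)] -/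
theorem perc_matH3avg_two_one (hd : 1 ≤ d) (hp0 : 0 < (p : ℝ))
    (hH : Summable fun y : Site d => euclidNorm y ^ 2 * tau d p 0 y) :
    matH3avg (unitVecs d) (fun a : Fin 3 => decide (a = 1)) (Letters.perc d p) 2 1 =
      ⨆ v, avgOn (unitVecs d) fun y => ENNReal.ofReal (2 * d * p * nobleH d 1 1 p (v - y)) := by
  rw [matH3avg_apply]
  exact perc_normOOavg_blockH3_two_one p hd hp0 hH

/-- **Averaged element `(1,1)`** (selector `a ↦ (a = 1)`, `p > 0`): `matH3avg_{1,1} = (2d)⁻² Σ_{|v|=|y|=1} 2dp ℋ^{1,1}_p(v − y)`.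
[cite: FitznerVanDerHofstad2017, §5.1 "Elements of the bounds" (arXiv:1506.07977v2 p. 49) with §6.1 p. 59; App. B (TeX l.10613)] [cite: FitznerVanDerHofstad2016NoBLE, (3.9); §5.3.3 (PTRF 169 (2017) p. 1099)] -/
theorem perc_matH3avg_one_one (hd : 1 ≤ d) (hp0 : 0 < (p : ℝ))
    (hH : Summable fun y : Site d => euclidNorm y ^ 2 * tau d p 0 y) :
    matH3avg (unitVecs d) (fun a : Fin 3 => decide (a = 1)) (Letters.perc d p) 1 1 =
      avgOn (unitVecs d) fun v => avgOn (unitVecs d) fun y => ENNReal.ofReal (2 * d * p * nobleH d 1 1 p (v - y)) := by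
  rw [matH3avg_apply]
  exact perc_normOOavg_blockH3_one_one p hd hp0 hH

end Elements

end Literature.Probability.FitznerVanDerHofstad2017.NobleBlocks
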